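import Literature.AlgebraicGeometry.HodgeTheory.CorrespondenceComposition
import Literature.AlgebraicGeometry.HodgeTheory.GlobalInvariantCyclesProofs

/-!
# Route NikulinTwinTransport · target X (stmt-HodgeConjecture-13674) and crux `HodgeSimilitudeAlgebraic`
# (stmt-HodgeConjecture-13676) — Gysin base change for the product square of three surfaces FROM
# Künneth spanning in one degree and one non-vanishing; hence composition of algebraic
# correspondences between surfaces

Every reduction of this crux in the tree — `hodgeSimilitudeAlgebraic_of_prime_anchors`,
`hodgeSimilitudeAlgebraic_iff_prime_twinTransport` (this seat), `similitudeAlgebraic_of_anchor`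
(hypothesis (C)), the target's `twinSimilitudeAlgebraic_of_twinTransport` (`hcomp`) and Buskin's
discharge path `Buskin2019_hodgeIsometry_algebraic_of_baseChange` (`hBC₀`) — carries the
COMPOSITION OF ALGEBRAIC CORRESPONDENCES between smooth projective surfaces as a hypothesis. The
Literature files `HodgeTheory/CorrespondenceComposition`, `Surfaces/K3CorrespondenceComposition`
reduce it (Fulton, *Intersection Theory*, Prop. 16.1.1; Buskin 2019, Lemma 6.3) to two inputs: Gysin
BASE CHANGE for the product square `A ⊗ (B ⊗ C) → B ⊗ C` over `A ⊗ B → B` ("needs the cross product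
/ Künneth formula `[M × N] = [M] × [N]` for the tree's singular (co)homology, absent") and the
multiplicativity `N² ∪ N² ⊆ N⁴` of algebraic classes (Chow's moving lemma).

This file proves that the base change input is MUCH LESS than the cross-product package: for smooth
projective surfaces `A, B, C` it follows, up to the scalar built into the tree's orientation
families, from

* (K1) Künneth SPANNING of the single group `H⁶((B ⊗ C)(ℂ); ℂ)` by the products `fst^* a ∪ snd^* b`
  of bidegrees `(2,4)` (with `b = p_C` one fixed class), `(4,2)` and `(3,3)`, and
* (K2) ONE non-vanishing: `(A ◁ fst)_* (snd^* snd^* p_C) ≠ 0` in `H⁰((A ⊗ B)(ℂ); ℂ)` (the fibre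
  integral of the point class),

both consequences of the Künneth theorem for `B(ℂ) × C(ℂ)` with field coefficients, and both
statements about ordinary cup products and one Gysin map — no cross product, no external
fundamental class `[M × N]`.

* `baseChange_of_kunneth` — **base change from (K1), (K2)**. Both sides are linear in the class on
  `B ⊗ C`, so the generators suffice. Bidegree `(2,4)`: the projection formula
  (`complexGysin_cup`) on both sides and `H⁰ = ℂ · 1` on the path-connected `B(ℂ)`, `(A ⊗ B)(ℂ)`
  give `t' • snd^* a` and `t • snd^* a`, `t ≠ 0` by (K2), so `c = t' t⁻¹`. Bidegrees `(4,2)`,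
  `(3,3)`: BOTH SIDES VANISH for degree reasons — through the defining square of the Gysin morphism
  (`capProduct_complexGysin`), `(a ∪ b) ⌢ x = b ⌢ (a ⌢ x)`, graded commutativity and the projection
  formula for `⌢`, the Poincaré dual of either side is `a ⌢ f_*(w)` with `w` a homology class of
  degree `5, 6` on the real `4`-manifold `B(ℂ)`, resp. `9, 10` on the `8`-manifold `(A ⊗ B)(ℂ)`,
  which is zero (`ComplexPoints.isZero_singularHomology_of_lt`), and Poincaré duality is injective.
* `compCorr_of_kunneth` — **composition of algebraic correspondences between smooth projective
  surfaces** (`CompCorr`, symbol for symbol the hypothesis `hC` / (C) of the crux reductions) from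
  `KunnethBC` ((K1) ∧ (K2) for all surface triples, `p_C` existentially) and `CupAlg` (the
  multiplicativity, Voisin II Prop. 9.20), through the tree's general `corr_comp_of_baseChange` and
  `corrCompClass_mem_algebraicClasses`.

So the formal debt "composition of correspondences" of this crux, of the target X and of item
13675 is now: Künneth spanning of `H⁶` of a product of two surfaces + the fibre integral of a point
+ `N² ∪ N² ⊆ N⁴` on a product of three surfaces. Nothing here is specific to K3 surfaces.

## References

* [Fulton1998] W. Fulton, Intersection Theory, 2nd ed. (1998), Prop. 1.7, §16.1 Prop. 16.1.1.
* [FultonYoungTableaux1997] W. Fulton, Young Tableaux (1997), App. B §B.1 (3)–(6).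
* [Buskin2019] N. Buskin, Every rational Hodge isometry between two K3 surfaces is algebraic,
  J. reine angew. Math. 755 (2019), Lemma 6.3.
* [HatcherAT2002] A. Hatcher, Algebraic Topology (2002), §3.1 p. 199, §3.3 p. 241, Thm. 3.26(c).
* [VoisinHodgeII2003] C. Voisin, Hodge Theory and Complex Algebraic Geometry II, §9.2.4 Prop. 9.20.
-/

noncomputable section

open CategoryTheory MonoidalCategory CartesianMonoidalCategory
open Literature.AlgebraicGeometry.Motives Literature.AlgebraicGeometry.HodgeTheory
open Literature.AlgebraicTopology.SingularHomology

namespace Summit.HodgeConjecture.HodgeConjecture.Theorems.NikulinTwinTransport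

variable {A B C : SchemeOver ℂ}

/-- **Gysin base change, up to a scalar, for the product square of three smooth projective
surfaces** `A ⊗ (B ⊗ C) → B ⊗ C` over `A ⊗ B → B` on `H⁶((B ⊗ C)(ℂ); ℂ)` —
`snd_{A,B}^* ∘ (fst_{B,C})_* = c • (A ◁ fst_{B,C})_* ∘ snd_{A,B⊗C}^*` — FROM Künneth spanning of
`H⁶((B ⊗ C)(ℂ))` by the products `fst^* a ∪ snd^* b` of bidegrees `(2,4)` (with `b = p_C` a fixed
top class), `(4,2)` and `(3,3)` (hypothesis `hK1`) and the non-vanishing of the fibre integral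
`(A ◁ fst)_* (π₃^* p_C) ∈ H⁰((A ⊗ B)(ℂ))` (hypothesis `hK2`). Proof: both sides are linear in
`z`, so it suffices to treat the generators. On `fst^* a ∪ snd^* p_C` the projection formula
(`complexGysin_cup`) gives `a ∪ fst_* snd^* p_C = t' • a` on the left (`H⁰(B(ℂ)) = ℂ · 1`,
`B(ℂ)` path connected) and `snd^* a ∪ (A ◁ fst)_* π₃^* p_C = t • snd^* a` on the right
(`H⁰((A ⊗ B)(ℂ)) = ℂ · 1`), `t ≠ 0` by `hK2`, whence `c = t' t⁻¹`; on the generators of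
bidegrees `(4,2)` and `(3,3)` both sides VANISH: by the defining square of the Gysin morphism
(`capProduct_complexGysin`), `(a ∪ b) ⌢ x = b ⌢ (a ⌢ x)`, graded commutativity and the
projection formula for `⌢` (`capProduct_map`), the Poincaré dual of either side is `a ⌢ f_* w`
with `w` a homology class of degree `6` or `5` (resp. `10` or `9`) pushed to the `4`-manifold
`B(ℂ)` (resp. the `8`-manifold `(A ⊗ B)(ℂ)`), where homology vanishes
(`isZero_singularHomology_of_lt`); Poincaré duality (`hμ`) is injective. For the complex
orientations and the Künneth decomposition `c = 1`; here `c` is whatever the orientation family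
gives. [cite: FultonYoungTableaux1997, Appendix B §B.1 (3)–(6)] [cite: HatcherAT2002, §3.3 p. 241 and Thm. 3.26(c)]
[cite: Fulton1998, Prop. 1.7 and §16.1] -/
theorem baseChange_of_kunneth (μ : OrientationFamily) (hμ : μ.HasPoincareDuality)
    (hA : IsSmoothProjective 2 A) (hB : IsSmoothProjective 2 B) (hC : IsSmoothProjective 2 C)
    (pC : complexBetti C (2 * 2))
    (hK1 : ∀ z : complexBetti (B ⊗ C) (2 * 1 + 2 * 2), z ∈ Submodule.span ℂ
      ((Set.range fun a : complexBetti B (2 * 1) =>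
          cupProduct (rfl : 2 * 1 + 2 * 2 = 2 * 1 + 2 * 2) (complexBetti.map (fst B C) (2 * 1) a)
            (complexBetti.map (snd B C) (2 * 2) pC)) ∪
        (Set.range fun ab : complexBetti B (2 * 2) × complexBetti C (2 * 1) =>
          cupProduct (rfl : 2 * 2 + 2 * 1 = 2 * 1 + 2 * 2) (complexBetti.map (fst B C) (2 * 2) ab.1)
            (complexBetti.map (snd B C) (2 * 1) ab.2)) ∪
        (Set.range fun ab : complexBetti B 3 × complexBetti C 3 =>
          cupProduct (rfl : 3 + 3 = 2 * 1 + 2 * 2) (complexBetti.map (fst B C) 3 ab.1)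
            (complexBetti.map (snd B C) 3 ab.2))))
    (hK2 : complexGysin μ (IsSmoothProjective.tensor_holds hA (IsSmoothProjective.tensor_holds hB hC))
        (IsSmoothProjective.tensor_holds hA hB) (A ◁ fst B C)
        (rfl : 2 * 2 + 2 * (2 + 2) = 0 + 2 * (2 + (2 + 2)))
        (complexBetti.map (snd A (B ⊗ C)) (2 * 2) (complexBetti.map (snd B C) (2 * 2) pC)) ≠ 0) :
    ∃ c : ℂ, ∀ z : complexBetti (B ⊗ C) (2 * 1 + 2 * 2),
      complexBetti.map (snd A B) (2 * 1)
        (complexGysin μ (IsSmoothProjective.tensor_holds hB hC) hB (fst B C)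
          (rfl : 2 * 1 + 2 * 2 + 2 * 2 = 2 * 1 + 2 * (2 + 2)) z) =
      c • complexGysin μ (IsSmoothProjective.tensor_holds hA (IsSmoothProjective.tensor_holds hB hC))
          (IsSmoothProjective.tensor_holds hA hB) (A ◁ fst B C)
          (rfl : 2 * 1 + 2 * 2 + 2 * (2 + 2) = 2 * 1 + 2 * (2 + (2 + 2)))
          (complexBetti.map (snd A (B ⊗ C)) (2 * 1 + 2 * 2) z) := by
  -- the varieties and their complex points
  have hBC := IsSmoothProjective.tensor_holds hB hC
  have hAB := IsSmoothProjective.tensor_holds hA hB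
  have hT := IsSmoothProjective.tensor_holds hA hBC
  haveI : PathConnectedSpace (ComplexPoints B) := pathConnectedSpace_complexPoints hB
  haveI : PathConnectedSpace (ComplexPoints (A ⊗ B)) := pathConnectedSpace_complexPoints hAB
  -- the two fibre integrals of `pC`: `fst_* snd^* pC = t' • 1`, `(A ◁ fst)_* π₃^* pC = t • 1`
  obtain ⟨t', ht'⟩ := singularCohomology.exists_eq_smul_one
    (complexGysin μ hBC hB (fst B C) (rfl : 2 * 2 + 2 * 2 = 0 + 2 * (2 + 2))
      (complexBetti.map (snd B C) (2 * 2) pC))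
  obtain ⟨t, ht⟩ := singularCohomology.exists_eq_smul_one
    (complexGysin μ hT hAB (A ◁ fst B C) (rfl : 2 * 2 + 2 * (2 + 2) = 0 + 2 * (2 + (2 + 2)))
      (complexBetti.map (snd A (B ⊗ C)) (2 * 2) (complexBetti.map (snd B C) (2 * 2) pC)))
  have ht0 : t ≠ 0 := by
    rintro rfl
    rw [zero_smul] at ht
    exact hK2 ht
  refine ⟨t' * t⁻¹, fun z => ?_⟩
  induction hK1 z using Submodule.span_induction with
  | zero => simp only [map_zero, smul_zero]
  | add x y _ _ hx hy =>
    simp only [map_add, smul_add]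
    rw [hx, hy]
  | smul a x _ hx =>
    simp only [map_smul]
    rw [hx, smul_comm]
  | mem x hx =>
    rcases hx with (⟨a, rfl⟩ | ⟨⟨a, b⟩, rfl⟩) | ⟨⟨a, b⟩, rfl⟩
    · -- bidegree (2,4): projection formula on both sides
      -- left: `fst_* (fst^* a ∪ snd^* pC) = a ∪ fst_* snd^* pC = t' • a`
      have eL : complexGysin μ hBC hB (fst B C) (rfl : 2 * 1 + 2 * 2 + 2 * 2 = 2 * 1 + 2 * (2 + 2))
          (cupProduct (rfl : 2 * 1 + 2 * 2 = 2 * 1 + 2 * 2) (complexBetti.map (fst B C) (2 * 1) a)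
            (complexBetti.map (snd B C) (2 * 2) pC)) = t' • a := by
        rw [complexGysin_cup hμ hBC hB (fst B C) rfl _ (rfl : 2 * 2 + 2 * 2 = 0 + 2 * (2 + 2))
          (Nat.add_zero _) a _, ht', map_smul, cupProduct_one]
      -- right: `snd^* (fst^* a ∪ snd^* pC) = (A ◁ fst)^* snd^* a ∪ π₃^* pC`
      have hu : complexBetti.map (snd A (B ⊗ C)) (2 * 1) (complexBetti.map (fst B C) (2 * 1) a) =
          complexBetti.map (A ◁ fst B C) (2 * 1) (complexBetti.map (snd A B) (2 * 1) a) := by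
        rw [← CategoryTheory.comp_apply, ← complexBetti.map_comp, ← whiskerLeft_snd,
          complexBetti.map_comp, CategoryTheory.comp_apply]
      have eR : complexGysin μ hT hAB (A ◁ fst B C)
          (rfl : 2 * 1 + 2 * 2 + 2 * (2 + 2) = 2 * 1 + 2 * (2 + (2 + 2)))
          (complexBetti.map (snd A (B ⊗ C)) (2 * 1 + 2 * 2)
            (cupProduct (rfl : 2 * 1 + 2 * 2 = 2 * 1 + 2 * 2) (complexBetti.map (fst B C) (2 * 1) a)
              (complexBetti.map (snd B C) (2 * 2) pC))) =
          t • complexBetti.map (snd A B) (2 * 1) a := by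
        rw [cupProduct_map, hu, complexGysin_cup hμ hT hAB (A ◁ fst B C) rfl _
          (rfl : 2 * 2 + 2 * (2 + 2) = 0 + 2 * (2 + (2 + 2))) (Nat.add_zero _) _ _, ht, map_smul,
          cupProduct_one]
      rw [eL, map_smul, eR, smul_smul, inv_mul_cancel_right₀ ht0]
    · -- bidegree (4,2): both sides vanish
      have hs : ((-1 : ℂ) ^ (2 * 2 * (2 * 1))) = 1 := by norm_num
      -- left
      have eL : complexGysin μ hBC hB (fst B C) (rfl : 2 * 1 + 2 * 2 + 2 * 2 = 2 * 1 + 2 * (2 + 2))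
          (cupProduct (rfl : 2 * 2 + 2 * 1 = 2 * 1 + 2 * 2) (complexBetti.map (fst B C) (2 * 2) a)
            (complexBetti.map (snd B C) (2 * 1) b)) = 0 := by
        haveI : Subsingleton (singularHomology ℂ ℂ (ComplexPoints B) (2 * 2 + 2 * 1)) :=
          ModuleCat.subsingleton_of_isZero (ComplexPoints.isZero_singularHomology_of_lt hB ℂ ℂ (by norm_num))
        apply ((hμ hB) (rfl : 2 * 1 + 2 * 1 = 2 * 2)).1
        rw [map_zero, poincareDualityMap_apply,
          capProduct_complexGysin hμ hBC hB (fst B C) _ (rfl : 2 * 1 + 2 * 2 + 2 * 1 = 2 * (2 + 2)) _,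
          cupProduct_gradedComm_holds ℂ _ (rfl : 2 * 2 + 2 * 1 = 2 * 1 + 2 * 2)
            (rfl : 2 * 1 + 2 * 2 = 2 * 1 + 2 * 2), hs, one_smul,
          cupProduct_capProduct (rfl : 2 * 1 + 2 * 2 = 2 * 1 + 2 * 2)
            (rfl : 2 * 1 + 2 * 2 + 2 * 1 = 2 * (2 + 2)) (rfl : 2 * 2 + 2 * 1 = 2 * 2 + 2 * 1)
            (rfl : 2 * 1 + (2 * 2 + 2 * 1) = 2 * (2 + 2)),
          capProduct_map, Subsingleton.elim (singularHomology.map ℂ ℂ _ (2 * 2 + 2 * 1) _) 0, map_zero]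
      -- right
      have hu : complexBetti.map (snd A (B ⊗ C)) (2 * 2) (complexBetti.map (fst B C) (2 * 2) a) =
          complexBetti.map (A ◁ fst B C) (2 * 2) (complexBetti.map (snd A B) (2 * 2) a) := by
        rw [← CategoryTheory.comp_apply, ← complexBetti.map_comp, ← whiskerLeft_snd,
          complexBetti.map_comp, CategoryTheory.comp_apply]
      have eR : complexGysin μ hT hAB (A ◁ fst B C)
          (rfl : 2 * 1 + 2 * 2 + 2 * (2 + 2) = 2 * 1 + 2 * (2 + (2 + 2)))
          (complexBetti.map (snd A (B ⊗ C)) (2 * 1 + 2 * 2)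
            (cupProduct (rfl : 2 * 2 + 2 * 1 = 2 * 1 + 2 * 2) (complexBetti.map (fst B C) (2 * 2) a)
              (complexBetti.map (snd B C) (2 * 1) b))) = 0 := by
        haveI : Subsingleton (singularHomology ℂ ℂ (ComplexPoints (A ⊗ B)) (2 * 2 + (2 * 1 + 2 * 2))) :=
          ModuleCat.subsingleton_of_isZero (ComplexPoints.isZero_singularHomology_of_lt hAB ℂ ℂ (by norm_num))
        rw [cupProduct_map, hu]
        apply ((hμ hAB) (rfl : 2 * 1 + (2 * 1 + 2 * 2) = 2 * (2 + 2))).1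
        rw [map_zero, poincareDualityMap_apply,
          capProduct_complexGysin hμ hT hAB (A ◁ fst B C) _
            (rfl : 2 * 1 + 2 * 2 + (2 * 1 + 2 * 2) = 2 * (2 + (2 + 2))) _,
          cupProduct_gradedComm_holds ℂ _ (rfl : 2 * 2 + 2 * 1 = 2 * 1 + 2 * 2)
            (rfl : 2 * 1 + 2 * 2 = 2 * 1 + 2 * 2), hs, one_smul,
          cupProduct_capProduct (rfl : 2 * 1 + 2 * 2 = 2 * 1 + 2 * 2)
            (rfl : 2 * 1 + 2 * 2 + (2 * 1 + 2 * 2) = 2 * (2 + (2 + 2)))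
            (rfl : 2 * 2 + (2 * 1 + 2 * 2) = 2 * 2 + (2 * 1 + 2 * 2))
            (rfl : 2 * 1 + (2 * 2 + (2 * 1 + 2 * 2)) = 2 * (2 + (2 + 2))),
          capProduct_map, Subsingleton.elim (singularHomology.map ℂ ℂ _ (2 * 2 + (2 * 1 + 2 * 2)) _) 0,
          map_zero]
      rw [eL, eR, map_zero, smul_zero]
    · -- bidegree (3,3): both sides vanish
      -- left
      have eL : complexGysin μ hBC hB (fst B C) (rfl : 2 * 1 + 2 * 2 + 2 * 2 = 2 * 1 + 2 * (2 + 2))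
          (cupProduct (rfl : 3 + 3 = 2 * 1 + 2 * 2) (complexBetti.map (fst B C) 3 a)
            (complexBetti.map (snd B C) 3 b)) = 0 := by
        haveI : Subsingleton (singularHomology ℂ ℂ (ComplexPoints B) (3 + 2 * 1)) :=
          ModuleCat.subsingleton_of_isZero (ComplexPoints.isZero_singularHomology_of_lt hB ℂ ℂ (by norm_num))
        apply ((hμ hB) (rfl : 2 * 1 + 2 * 1 = 2 * 2)).1
        rw [map_zero, poincareDualityMap_apply,
          capProduct_complexGysin hμ hBC hB (fst B C) _ (rfl : 2 * 1 + 2 * 2 + 2 * 1 = 2 * (2 + 2)) _,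
          cupProduct_gradedComm_holds ℂ _ (rfl : 3 + 3 = 2 * 1 + 2 * 2)
            (rfl : 3 + 3 = 2 * 1 + 2 * 2), map_smul, LinearMap.smul_apply,
          cupProduct_capProduct (rfl : 3 + 3 = 2 * 1 + 2 * 2)
            (rfl : 2 * 1 + 2 * 2 + 2 * 1 = 2 * (2 + 2)) (rfl : 3 + 2 * 1 = 3 + 2 * 1)
            (rfl : 3 + (3 + 2 * 1) = 2 * (2 + 2)),
          map_smul, capProduct_map, Subsingleton.elim (singularHomology.map ℂ ℂ _ (3 + 2 * 1) _) 0, map_zero,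
          smul_zero]
      -- right
      have hu : complexBetti.map (snd A (B ⊗ C)) 3 (complexBetti.map (fst B C) 3 a) =
          complexBetti.map (A ◁ fst B C) 3 (complexBetti.map (snd A B) 3 a) := by
        rw [← CategoryTheory.comp_apply, ← complexBetti.map_comp, ← whiskerLeft_snd,
          complexBetti.map_comp, CategoryTheory.comp_apply]
      have eR : complexGysin μ hT hAB (A ◁ fst B C)
          (rfl : 2 * 1 + 2 * 2 + 2 * (2 + 2) = 2 * 1 + 2 * (2 + (2 + 2)))
          (complexBetti.map (snd A (B ⊗ C)) (2 * 1 + 2 * 2)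
            (cupProduct (rfl : 3 + 3 = 2 * 1 + 2 * 2) (complexBetti.map (fst B C) 3 a)
              (complexBetti.map (snd B C) 3 b))) = 0 := by
        haveI : Subsingleton (singularHomology ℂ ℂ (ComplexPoints (A ⊗ B)) (3 + (2 * 1 + 2 * 2))) :=
          ModuleCat.subsingleton_of_isZero (ComplexPoints.isZero_singularHomology_of_lt hAB ℂ ℂ (by norm_num))
        rw [cupProduct_map, hu]
        apply ((hμ hAB) (rfl : 2 * 1 + (2 * 1 + 2 * 2) = 2 * (2 + 2))).1
        rw [map_zero, poincareDualityMap_apply,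
          capProduct_complexGysin hμ hT hAB (A ◁ fst B C) _
            (rfl : 2 * 1 + 2 * 2 + (2 * 1 + 2 * 2) = 2 * (2 + (2 + 2))) _,
          cupProduct_gradedComm_holds ℂ _ (rfl : 3 + 3 = 2 * 1 + 2 * 2)
            (rfl : 3 + 3 = 2 * 1 + 2 * 2), map_smul, LinearMap.smul_apply,
          cupProduct_capProduct (rfl : 3 + 3 = 2 * 1 + 2 * 2)
            (rfl : 2 * 1 + 2 * 2 + (2 * 1 + 2 * 2) = 2 * (2 + (2 + 2)))
            (rfl : 3 + (2 * 1 + 2 * 2) = 3 + (2 * 1 + 2 * 2))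
            (rfl : 3 + (3 + (2 * 1 + 2 * 2)) = 2 * (2 + (2 + 2))),
          map_smul, capProduct_map, Subsingleton.elim (singularHomology.map ℂ ℂ _ (3 + (2 * 1 + 2 * 2)) _) 0,
          map_zero, smul_zero]
      rw [eL, eR, map_zero, smul_zero]

/-! ### Composition of algebraic correspondences between surfaces, from the Künneth input -/

/-- `CompCorr`: composition of algebraic correspondences between smooth projective surfaces — symbol
for symbol the hypothesis `hC` of `NikulinTwinTransportHodgeSimilitudeAlgebraicPrimes` /
`NikulinTwinTransportTwinSimilitudeReduction`. Local notation only. -/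
local notation3 (prettyPrint := false) "CompCorr" =>
  ∀ (μ : OrientationFamily), μ.HasPoincareDuality →
    ∀ (A B C : SchemeOver ℂ) (hA : IsSmoothProjective 2 A) (hB : IsSmoothProjective 2 B)
      (hC : IsSmoothProjective 2 C),
      ∀ γ ∈ algebraicClasses (MonoidalCategoryStruct.tensorObj A B) 2,
        ∀ γ₁ ∈ algebraicClasses (MonoidalCategoryStruct.tensorObj B C) 2,
          ∃ γ₂ ∈ algebraicClasses (MonoidalCategoryStruct.tensorObj A C) 2,
            ∀ x : complexBetti C (2 * 1),
              complexGysin μ (IsSmoothProjective.tensor_holds hA hC) hA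
                  (SemiCartesianMonoidalCategory.fst A C)
                  (rfl : 2 * 1 + 2 * 2 + 2 * 2 = 2 * 1 + 2 * (2 + 2))
                  (cupProduct (rfl : 2 * 1 + 2 * 2 = 2 * 1 + 2 * 2)
                    (complexBetti.map (SemiCartesianMonoidalCategory.snd A C) (2 * 1) x) γ₂) =
                complexGysin μ (IsSmoothProjective.tensor_holds hA hB) hA
                  (SemiCartesianMonoidalCategory.fst A B)
                  (rfl : 2 * 1 + 2 * 2 + 2 * 2 = 2 * 1 + 2 * (2 + 2))
                  (cupProduct (rfl : 2 * 1 + 2 * 2 = 2 * 1 + 2 * 2)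
                    (complexBetti.map (SemiCartesianMonoidalCategory.snd A B) (2 * 1)
                      (complexGysin μ (IsSmoothProjective.tensor_holds hB hC) hB
                        (SemiCartesianMonoidalCategory.fst B C)
                        (rfl : 2 * 1 + 2 * 2 + 2 * 2 = 2 * 1 + 2 * (2 + 2))
                        (cupProduct (rfl : 2 * 1 + 2 * 2 = 2 * 1 + 2 * 2)
                          (complexBetti.map (SemiCartesianMonoidalCategory.snd B C) (2 * 1) x)
                          γ₁)))
                    γ)

/-- `KunnethBC`: **the Künneth input of base change** — for every orientation family with Poincaré
duality and all smooth projective surfaces `A, B, C` there is a class `p_C ∈ H⁴(C(ℂ); ℂ)`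
(intended: the class of a point) such that (K1) `H⁶((B ⊗ C)(ℂ); ℂ)` is spanned by the Künneth
products `fst^* a ∪ snd^* p_C` (`a ∈ H²(B)`), `fst^* a ∪ snd^* b` (`a ∈ H⁴(B)`, `b ∈ H²(C)`) and
`fst^* a ∪ snd^* b` (`a ∈ H³(B)`, `b ∈ H³(C)`), and (K2) the fibre integral
`(A ◁ fst)_* (snd^* snd^* p_C) ∈ H⁰((A ⊗ B)(ℂ); ℂ)` is non-zero. Both follow from the Künneth
formula for `X(ℂ) × Y(ℂ)` (and `∫_C p_C = 1`), absent from the tree's singular (co)homology.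
Local notation only. -/
local notation3 (prettyPrint := false) "KunnethBC" =>
  ∀ (μ : OrientationFamily), μ.HasPoincareDuality →
    ∀ (A B C : SchemeOver ℂ) (hA : IsSmoothProjective 2 A) (hB : IsSmoothProjective 2 B)
      (hC : IsSmoothProjective 2 C),
      ∃ pC : complexBetti C (2 * 2),
        (∀ z : complexBetti (MonoidalCategoryStruct.tensorObj B C) (2 * 1 + 2 * 2),
          z ∈ Submodule.span ℂ
            ((Set.range fun a : complexBetti B (2 * 1) =>
                cupProduct (rfl : 2 * 1 + 2 * 2 = 2 * 1 + 2 * 2)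
                  (complexBetti.map (SemiCartesianMonoidalCategory.fst B C) (2 * 1) a)
                  (complexBetti.map (SemiCartesianMonoidalCategory.snd B C) (2 * 2) pC)) ∪
              (Set.range fun ab : complexBetti B (2 * 2) × complexBetti C (2 * 1) =>
                cupProduct (rfl : 2 * 2 + 2 * 1 = 2 * 1 + 2 * 2)
                  (complexBetti.map (SemiCartesianMonoidalCategory.fst B C) (2 * 2) ab.1)
                  (complexBetti.map (SemiCartesianMonoidalCategory.snd B C) (2 * 1) ab.2)) ∪
              (Set.range fun ab : complexBetti B 3 × complexBetti C 3 =>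
                cupProduct (rfl : 3 + 3 = 2 * 1 + 2 * 2)
                  (complexBetti.map (SemiCartesianMonoidalCategory.fst B C) 3 ab.1)
                  (complexBetti.map (SemiCartesianMonoidalCategory.snd B C) 3 ab.2)))) ∧
        complexGysin μ
            (IsSmoothProjective.tensor_holds hA (IsSmoothProjective.tensor_holds hB hC))
            (IsSmoothProjective.tensor_holds hA hB)
            (MonoidalCategoryStruct.whiskerLeft A (SemiCartesianMonoidalCategory.fst B C))
            (rfl : 2 * 2 + 2 * (2 + 2) = 0 + 2 * (2 + (2 + 2)))
            (complexBetti.map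
              (SemiCartesianMonoidalCategory.snd A (MonoidalCategoryStruct.tensorObj B C)) (2 * 2)
              (complexBetti.map (SemiCartesianMonoidalCategory.snd B C) (2 * 2) pC)) ≠ 0

/-- `CupAlg`: **the multiplicativity `N² H⁴ ∪ N² H⁴ ⊆ N⁴ H⁸` of algebraic classes on the triple
products of smooth projective surfaces** (Voisin II Prop. 9.20 for `(l, k) = (2, 2)`, where Chow's
moving lemma enters; the shape of the conclusion of the tree's
`cupProduct_mem_algebraicClasses_of_moving` and of the hypothesis `hCUP` of
`corrCompClass_mem_algebraicClasses`). Local notation only. -/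
local notation3 (prettyPrint := false) "CupAlg" =>
  ∀ (A B C : SchemeOver ℂ), IsSmoothProjective 2 A → IsSmoothProjective 2 B →
    IsSmoothProjective 2 C →
    ∀ a ∈ algebraicClasses (MonoidalCategoryStruct.tensorObj A (MonoidalCategoryStruct.tensorObj B C)) 2,
      ∀ b ∈ algebraicClasses (MonoidalCategoryStruct.tensorObj A (MonoidalCategoryStruct.tensorObj B C)) 2,
        cupProduct ((Nat.mul_add 2 2 2).symm : 2 * 2 + 2 * 2 = 2 * (2 + 2)) a b ∈
          algebraicClasses (MonoidalCategoryStruct.tensorObj A (MonoidalCategoryStruct.tensorObj B C)) (2 + 2)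

/-- **Composition of algebraic correspondences between smooth projective surfaces from the Künneth
input and the multiplicativity of algebraic classes**: the hypothesis `hC` (= (C), `CompCorr`) of the
crux reductions `hodgeSimilitudeAlgebraic_of_prime_anchors`, `similitudeAlgebraic_of_anchor`, … —
for algebraic `γ ∈ N² H⁴((A ⊗ B)(ℂ))`, `γ₁ ∈ N² H⁴((B ⊗ C)(ℂ))` an algebraic `γ₂` on `A ⊗ C` with
`[γ₂]_* = [γ]_* ∘ [γ₁]_*` on `H²(C(ℂ); ℂ)` — follows from `KunnethBC` and `CupAlg`: base change by
`baseChange_of_kunneth`, then Fulton's composition rule and Buskin's Lemma 6.3 on the coniveau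
carriers (the tree's `corr_comp_of_baseChange`, `corrCompClass_mem_algebraicClasses`), with
`γ₂ = c • p₁₃_*(p₁₂^* γ ∪ p₂₃^* γ₁)`. [cite: Fulton1998, §16.1 Prop. 16.1.1 and Def. 16.1.2]
[cite: Buskin2019, Lemma 6.3] [cite: VoisinHodgeII2003, §9.2.4 Prop. 9.20] -/
theorem compCorr_of_kunneth (hK : KunnethBC) (hCUP : CupAlg) : CompCorr := by
  intro μ hμ A B C hA hB hC γ hγ γ₁ hγ₁
  obtain ⟨pC, hK1, hK2⟩ := hK μ hμ A B C hA hB hC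
  obtain ⟨c, hc⟩ := baseChange_of_kunneth μ hμ hA hB hC pC hK1 hK2
  refine ⟨c • complexGysin μ
      (IsSmoothProjective.tensor_holds hA (IsSmoothProjective.tensor_holds hB hC))
      (IsSmoothProjective.tensor_holds hA hC) (A ◁ snd B C)
      (rfl : 2 * (2 + 2) + 2 * (2 + 2) = 2 * 2 + 2 * (2 + (2 + 2)))
      (cupProduct ((Nat.mul_add 2 2 2).symm : 2 * 2 + 2 * 2 = 2 * (2 + 2))
        (complexBetti.map (A ◁ fst B C) (2 * 2) γ) (complexBetti.map (snd A (B ⊗ C)) (2 * 2) γ₁)),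
    Submodule.smul_mem _ c
      (corrCompClass_mem_algebraicClasses hμ hA hB hC (e := 2) (e' := 2) (e'' := 2) rfl
        (hCUP A B C hA hB hC) hγ hγ₁),
    fun y => ?_⟩
  exact corr_comp_of_baseChange hμ hA hB hC (e := 2) (j := 2 * 2) (k := 2 * 2) (d := 2 * (2 + 2))
    (a := 2 * 1) (a₁ := 2 * 1) (a₂ := 2 * 1) rfl rfl rfl ((Nat.mul_add 2 2 2).symm) γ γ₁ c hc y

end Summit.HodgeConjecture.HodgeConjecture.Theorems.NikulinTwinTransport

end
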